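import Summits.NavierStokesRegularity.NavierStokesRegularity.Theorems.QuarterBudgetTraceExtinctApexZoomDataOfFE
import Literature.Analysis.FluidPDE.LocalPlainPressureBound
import HarnessLib

/-!
# Route QuarterBudgetTrace, support `BudgetedExtinctApex` (stmt-NavierStokesRegularity-26014) — brick «ExtinctApexOfFE», part 2:
# the plain pressure bound, with the zoom data KEPT in the conclusion

Seat ns-es-p1 g3 (KEY-NS #81); planner ns-idea-9 g2.  The tree's `extinctApexD_of_L3trace_unit_const`
(…ExtinctApexPressureUnitConst, nsreg-C26 g2) re-run VERBATIM on `exists_extinctApex_zoomData_unit_const_of_FE` (energy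
flatness instead of the `L³` trace), and with the scales `μ_j` and the strong `L³(Q(a))` convergence of the velocity zooms
retained in the conclusion — the budget brick `…QuarterBudgetTraceZoomBudgetInheritance.slabBudget_of_zoomLimit` consumes them.
WHAT THIS IS NOT: not `BudgetedExtinctApex`, not NS regularity; no summit statement is proved.
[folklore; AlbrittonBarker2019 §3; SereginSverak2009 (as13); WangZhang2016 §4 (4.3)–(4.4); Seregin2014 §6.6]
-/

noncomputable section

set_option linter.dupNamespace false

namespace Summit.NavierStokesRegularity.NavierStokesRegularity.Theorems.QuarterBudgetTraceExtinctApexOfFE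

open MeasureTheory Set Function Filter Topology TopologicalSpace Metric
open Literature.Analysis.FluidPDE Literature.Analysis.FluidPDE.SereginSverak2009
open Summit.NavierStokesRegularity.NavierStokesRegularity.Theorems.TypeITraceScarL3
open Summit.NavierStokesRegularity.NavierStokesRegularity.Theorems
open scoped NNReal ENNReal InnerProductSpace RealInnerProductSpace

/-- **Extinct Type-I apex with plain pressure bound and zoom data, from energy flatness.**  `T > 0`, `(u, p)` classical at unit
viscosity on `[0,T)`, Leray–Hopf on `[0,T]`, eventual rate `C/√(T−t)` (`C ≥ 0` given), NOT backward bounded at `(T, x₀)`, and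
`r⁻¹∫_{B(x₀,r)}|u(T)|² → 0`: then there are scales `μ_j → 0⁺` and `(U, P, G, M, D₀)` — suitable in every `Q(a)` with weak gradient
`G`, `𝐈(Q(a)) ≤ M`, PLAIN `D(Q_r(z₀))[P] ≤ D₀` at every apex `z₀.1 ≤ 0`, rate `C/√(−s)`, weakly vanishing top, backward-singular
origin — and the zooms `μ_j u(T+μ_j²s, x₀+μ_j y)` converge to `U` in `L³(Q(a))` for every `a`.
[folklore; AlbrittonBarker2019 §3; SereginSverak2009 (as13); WangZhang2016 §4; Seregin2014 §6.6] -/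
theorem extinctApexD_zoomData_unit_const_of_FE {T : ℝ} (hT : 0 < T)
    {u : ℝ → EuclideanSpace ℝ (Fin 3) → EuclideanSpace ℝ (Fin 3)} {p : ℝ → EuclideanSpace ℝ (Fin 3) → ℝ}
    (hsol : IsClassicalNSSolutionOn (Ico 0 T) 1 0 u p) (hLH : IsLerayHopfOn T 1 0 (u 0) u)
    {C : ℝ} (hC0 : 0 ≤ C) (hrateT : ∀ᶠ t in 𝓝[<] T, ∀ x, ‖u t x‖ ≤ C / Real.sqrt (T - t))
    (x₀ : EuclideanSpace ℝ (Fin 3)) (hnotbd : ¬ IsBackwardBoundedAt u T x₀)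
    (hFE : Tendsto (fun r : ℝ => r⁻¹ * ∫ x in ball x₀ r, ‖u T x‖ ^ 2) (𝓝[>] 0) (𝓝 0)) :
    ∃ (μ : ℕ → ℝ) (U : ℝ → EuclideanSpace ℝ (Fin 3) → EuclideanSpace ℝ (Fin 3)) (P : ℝ → EuclideanSpace ℝ (Fin 3) → ℝ)
      (G : ℝ → EuclideanSpace ℝ (Fin 3) → EuclideanSpace ℝ (Fin 3) →L[ℝ] EuclideanSpace ℝ (Fin 3))
      (M D₀ : ℝ≥0),
      (∀ j, 0 < μ j) ∧ Tendsto μ atTop (𝓝 0) ∧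
      (∀ a : ℝ, 0 < a → IsSuitableWeakSolutionInBall a (0 : ℝ × EuclideanSpace ℝ (Fin 3)) U P) ∧
      (∀ a : ℝ, 0 < a →
        HasWeakSpatialGradientOn (parabolicCylinderOpens a (0 : ℝ × EuclideanSpace ℝ (Fin 3))) U G) ∧
      (∀ a : ℝ, 0 < a → typeIBound (parabolicCylinder a (0 : ℝ × EuclideanSpace ℝ (Fin 3))) U P G ≤ M) ∧
      (∀ z₀ : ℝ × EuclideanSpace ℝ (Fin 3), z₀.1 ≤ 0 → ∀ r : ℝ, 0 < r → cknD r z₀ P ≤ D₀) ∧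
      (∀ s : ℝ, s < 0 → ∀ᵐ y : EuclideanSpace ℝ (Fin 3), ‖U s y‖ ≤ C / Real.sqrt (-s)) ∧
      (∀ φ : EuclideanSpace ℝ (Fin 3) → EuclideanSpace ℝ (Fin 3), ContDiff ℝ (⊤ : ℕ∞) φ →
        HasCompactSupport φ → ∀ ε : ℝ, 0 < ε →
          ∃ s₀ : ℝ, s₀ < 0 ∧ ∀ᵐ s ∂(volume.restrict (Ioo s₀ 0)), |∫ y, ⟪U s y, φ y⟫| ≤ ε) ∧
      IsBackwardSingularPoint U (0 : ℝ × EuclideanSpace ℝ (Fin 3)) ∧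
      (∀ a : ℝ, 0 < a →
        Tendsto (fun j => eLpNorm
            (uncurry ((μ j) • stPull ((μ j) ^ 2) (μ j) T x₀ u) - uncurry U) 3
            (volume.restrict (parabolicCylinder a (0 : ℝ × EuclideanSpace ℝ (Fin 3)))))
          atTop (𝓝 0)) := by
  -- ## (1) the apex with its zoom data (constant exposed); then verbatim `extinctApexD_of_L3trace_unit`
  have hI : IsTypeIBlowup u T := ⟨C, hrateT⟩
  obtain ⟨μ, U, P, G, M, hμ, hμ0, h1, h2, h3, h4, h5, h6, hdata⟩ :=
    exists_extinctApex_zoomData_unit_const_of_FE hT hsol hLH hC0 hrateT x₀ hnotbd hFE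
  -- ## (2) the vertex frame: `v = R u(T + R²·, x₀ + R·)`, `πv = R² q(…)`, with `𝐈(Q(0,1/2)) < ⊤`
  obtain ⟨r₀, M₀, T₁, hr₀, hT₁, hMor⟩ := morrey_of_typeI one_pos hT hsol hLH hI
  obtain ⟨R, α, β, hR, hα, hβ, hβeq, hαeq, hβT, hball, hGv, htypeI⟩ :=
    exists_zoom_typeIBound_lt_top_of_morrey one_pos hT hsol hLH hr₀ hT₁ hMor x₀
  rw [div_one] at hβeq hαeq
  set q : ℝ → EuclideanSpace ℝ (Fin 3) → ℝ :=
    fun t x => p t x - (p t 0 - normalisedPressure (u t) 0) with hq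
  set v : ℝ → EuclideanSpace ℝ (Fin 3) → EuclideanSpace ℝ (Fin 3) := α • stPull β R T x₀ u with hv
  set πv : ℝ → EuclideanSpace ℝ (Fin 3) → ℝ := α ^ 2 • stPull β R T x₀ q with hπv
  set Gv : ℝ → EuclideanSpace ℝ (Fin 3) → EuclideanSpace ℝ (Fin 3) →L[ℝ] EuclideanSpace ℝ (Fin 3) :=
    (α * R) • stPull β R T x₀ (fun t x => fderiv ℝ (u t) x) with hGvdef
  have hπv1 : πv = R ^ 2 • stPull (R ^ 2) R T x₀ q := by rw [hπv, hαeq, hβeq]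
  set z₀ : ℝ × EuclideanSpace ℝ (Fin 3) := ((0 : ℝ), (0 : EuclideanSpace ℝ (Fin 3))) with hz₀
  have hz₀0 : z₀ = 0 := rfl
  -- the distributional pair on `Q(0,1)` and the sub-cylinder `Q(0, 1/2)`
  have hdist : IsDistributionalNSSolutionOn
      (parabolicCylinderOpens 1 (0 : ℝ × EuclideanSpace ℝ (Fin 3))) 1 0 v πv := hball.1.distributional
  have hsub : parabolicCylinder (1 / 2) z₀ ⊆
      ((parabolicCylinderOpens 1 (0 : ℝ × EuclideanSpace ℝ (Fin 3)) :
        Opens (ℝ × EuclideanSpace ℝ (Fin 3))) : Set (ℝ × EuclideanSpace ℝ (Fin 3))) := by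
    rw [coe_parabolicCylinderOpens, hz₀0]
    exact SuitableCompactness.parabolicCylinder_zero_mono (by norm_num) (by norm_num)
  -- `M₁ = 𝐈(Q(0, 1/2))` bounds `C` on every sub-cylinder
  set M₁ : ℝ≥0∞ := typeIBound (parabolicCylinder (1 / 2) (0 : ℝ × EuclideanSpace ℝ (Fin 3))) v πv Gv
    with hM₁
  have hM₁top : M₁ ≠ ⊤ := htypeI.ne
  have hC : ∀ (z : ℝ × EuclideanSpace ℝ (Fin 3)) (r : ℝ), 0 < r →
      parabolicCylinder r z ⊆ parabolicCylinder (1 / 2) z₀ → cknC r z v ≤ M₁ := by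
    intro z r hr hz
    rw [hz₀0] at hz
    exact cknC_le_of_typeIBound_le (le_refl M₁) subset_rfl hr hz
  -- `M₂ = D(Q(0, 1/2))[πv]` is finite (`πv ∈ L^{3/2}(Q(0,1))`)
  set M₂ : ℝ≥0∞ := cknD (1 / 2) z₀ πv with hM₂
  have hM₂top : M₂ ≠ ⊤ := by
    obtain ⟨h32, h32', h32r⟩ := threeHalves_facts
    have hm : MemLp (uncurry πv) (3 / 2)
        (volume.restrict (parabolicCylinder 1 (0 : ℝ × EuclideanSpace ℝ (Fin 3)))) := hball.2.2.2
    have h2 := hm.2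
    rw [eLpNorm_eq_lintegral_rpow_enorm_toReal (by norm_num) h32', h32r] at h2
    have hfin : ∫⁻ z in parabolicCylinder 1 (0 : ℝ × EuclideanSpace ℝ (Fin 3)),
        ‖uncurry πv z‖ₑ ^ (3 / 2 : ℝ) < ⊤ := by
      by_contra htop
      rw [not_lt, top_le_iff] at htop
      rw [htop, ENNReal.top_rpow_of_pos (by norm_num)] at h2
      exact lt_irrefl _ h2
    have hfin' : ∫⁻ z in parabolicCylinder (1 / 2) z₀, ‖πv z.1 z.2‖ₑ ^ (3 / 2 : ℝ) < ⊤ := by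
      refine lt_of_le_of_lt (lintegral_mono_set ?_) hfin
      rw [hz₀0]
      exact SuitableCompactness.parabolicCylinder_zero_mono (by norm_num) (by norm_num)
    rw [hM₂, cknD]
    exact ENNReal.mul_ne_top (ENNReal.inv_ne_top.2 (pow_ne_zero _ (by simp))) hfin'.ne
  -- ## (3) Seregin–Šverák's iterated pressure decay: plain `D ≤ κ(M₁ + M₂)` on the window
  obtain ⟨κ, hκ⟩ := exists_cknD_le_window_of_cknC_le
  set K : ℝ≥0∞ := κ * (M₁ + M₂) with hK
  have hKtop : K ≠ ⊤ := ENNReal.mul_ne_top ENNReal.coe_ne_top (ENNReal.add_ne_top.2 ⟨hM₁top, hM₂top⟩)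
  have hwin : ∀ z : ℝ × EuclideanSpace ℝ (Fin 3), z.1 ≤ z₀.1 → z₀.1 - 3 / 16 ≤ z.1 →
      dist z.2 z₀.2 < 1 / 4 → ∀ r ∈ Ioc (0 : ℝ) (1 / 4), cknD r z πv ≤ K := by
    intro z hz1 hz2 hz3 r hr
    have h := hκ (parabolicCylinderOpens 1 (0 : ℝ × EuclideanSpace ℝ (Fin 3))) v πv hdist z₀ (1 / 2)
      (by norm_num) hsub M₁ M₂ hC le_rfl z hz1 (by norm_num at hz2 ⊢; linarith) (by norm_num; exact hz3)
      r ⟨hr.1, by norm_num; exact hr.2⟩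
    rw [hK]
    exact h
  -- ## (4) the zoomed pressures of the zoom data are `(μ_j/R)`-zooms of `πv`
  set lam : ℕ → ℝ := fun j => μ j / R with hlam
  have hlampos : ∀ j, 0 < lam j := fun j => show 0 < μ j / R from div_pos (hμ j) hR
  have hlam0 : Tendsto lam atTop (𝓝 0) := by
    have := hμ0.div_const R
    rwa [zero_div] at this
  have hzoomπ : ∀ j, (lam j) ^ 2 • stPull ((lam j) ^ 2) (lam j) z₀.1 z₀.2 πv =
      (μ j) ^ 2 • stPull ((μ j) ^ 2) (μ j) T x₀ q := by
    intro j
    have e : lam j * R = μ j := by rw [hlam]; field_simp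
    show (lam j) ^ 2 • stPull ((lam j) ^ 2) (lam j) (0 : ℝ) (0 : EuclideanSpace ℝ (Fin 3)) πv = _
    rw [hπv1, zoom_zoom_pressure, e]
  have hpm : AEStronglyMeasurable (uncurry πv) (volume.restrict (parabolicCylinder (1 / 2) z₀)) :=
    hball.2.2.2.1.mono_measure (Measure.restrict_mono (by rwa [coe_parabolicCylinderOpens] at hsub) le_rfl)
  have hπ : ∀ a : ℝ, 0 < a → MemLp (uncurry P) (3 / 2)
      (volume.restrict (parabolicCylinder a (0 : ℝ × EuclideanSpace ℝ (Fin 3)))) :=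
    fun a ha => (hdata a ha).2.1
  have hweak : ∀ a : ℝ, 0 < a → ∀ g : ℝ × EuclideanSpace ℝ (Fin 3) → ℝ,
      MemLp g 3 (volume.restrict (parabolicCylinder a (0 : ℝ × EuclideanSpace ℝ (Fin 3)))) →
      Tendsto (fun j => ∫ w' in parabolicCylinder a (0 : ℝ × EuclideanSpace ℝ (Fin 3)),
          ((lam j) ^ 2 • stPull ((lam j) ^ 2) (lam j) z₀.1 z₀.2 πv) w'.1 w'.2 * g w')
        atTop (𝓝 (∫ w' in parabolicCylinder a (0 : ℝ × EuclideanSpace ℝ (Fin 3)), P w'.1 w'.2 * g w')) := by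
    intro a ha g hg
    simp only [hzoomπ]
    exact (hdata a ha).2.2.2 g hg
  -- ## (5) weak lower semicontinuity: the limit pressure inherits `D ≤ K` at every apex
  have hvi : ∀ z : ℝ × EuclideanSpace ℝ (Fin 3), z.1 ≤ 0 → ∀ r : ℝ, 0 < r → cknD r z P ≤ K :=
    fun z hz r hr => blowup_cknD_le_apex_of_tendsto hpm (by norm_num : (0 : ℝ) < 3 / 16)
      (by norm_num : (0 : ℝ) < 1 / 4) (by norm_num : (0 : ℝ) < 1 / 4) hwin hlampos hlam0 hπ hweak hz hr
  -- ## (6) assemble, with `D₀ = K` as a finite constant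
  refine ⟨μ, U, P, G, M, K.toNNReal, hμ, hμ0, h1, h2, h3, ?_, h4, h5, h6, fun a ha => (hdata a ha).2.2.1⟩
  intro z hz r hr
  rw [ENNReal.coe_toNNReal hKtop]
  exact hvi z hz r hr


end Summit.NavierStokesRegularity.NavierStokesRegularity.Theorems.QuarterBudgetTraceExtinctApexOfFE

end
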